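import Summits.HubbardSuperconductivity.HubbardSuperconductivity.Theorems.WeakCouplingBCSKlLindhardEnclosureFloorPieceLo
import Summits.HubbardSuperconductivity.HubbardSuperconductivity.Theorems.WeakCouplingBCSKlLindhardEnclosureFloorCore
import Summits.HubbardSuperconductivity.HubbardSuperconductivity.Theorems.WeakCouplingBCSKlLindhardEnclosureHyperbolaABCore
import Summits.HubbardSuperconductivity.HubbardSuperconductivity.Theorems.WeakCouplingBCSKlLindhardEnclosureJensen

/-!
# KL-MARGIN-SCAN reader (22) «kernel-lindhard-enclosure» — THE BOUNDARY FLOOR RULE IS SOUND: `floorBdrySoundOrd : ∀ P, FloorBdrySoundOrd P`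

The last open rule predicate of the (22) instrument (`…FloorRulesOrd.FloorBdrySoundOrd`, the ORIENTED boundary-floor rule of record) is a
theorem for every parameter record, and with `…Jensen.floorInsideSoundOrd` the instrument's FLOOR side is discharged outright:
**`floorSoundAt_holds : ∀ P t, FloorSoundAt P t`**.  Assembly:
* §1 `Params.floor_total_le` — the common core: the kernel-agnostic 2-D substitution floor `…FloorCore.floor2D_core` with the minorant
  `fminR` of `…FloorPiece`, breakpoints `linGridZ aIn0 aIn1 MA m / 2^40`, piece constants `pieceLoR` (`…FloorPieceLo.pieceLoR_le_integral`),
  against the kernel total `Σ_m bdryPieceLo` (`…FloorPieceLo.bdryPieceLo_le`, `…HyperbolaABCore.list_range_map_sum`) and the outer `fdivZ`;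
* §2 the two straddler orientations (`Params.floor_sh`, `Params.floor_nsh`): the records give the real substitution data — `|sin| ≤ σ/10⁴`
  from the CHECKED hints (`abs_sin_le_of_sinHiOK` on the cell cosine ranges), injectivity of `cos` and the inner boxes from `cosInnerZ`
  (`cosInnerZ_eq`, `injOn_cos_of_cosDirZ`, `cosInnerZ_sound` with the point records of `…CosRange`), domination `fminR_le_integrand_sh/_nsh`;
* §3 `floorBdrySoundOrd` — unpacking `Params.floorBdry` (the `match` on the two inner boxes, the guard conjunction; every failed branch is `0 ≤`
  the cell integral) and `floorSoundAt_holds`.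
Honest framing: instrument soundness only (the floor side of `sound`); the ceiling side is `…CeilBdry` + the tip rule; nothing here asserts a
KL margin at any `t′ ≠ 0`, a channel order, `K₃`, `U₀`, the window or superconductivity; a Kohn–Luttinger `O(U²)` channel statement is not
ODLRO and nothing in this file proves superconductivity in the Hubbard model.  (p1 g26, 2026-08-29.)
-/

noncomputable section

set_option linter.dupNamespace false

namespace Summit.HubbardSuperconductivity.HubbardSuperconductivity.Theorems.KlLindhardEnclosure

open Real Set MeasureTheory Literature.MathematicalPhysics.QuantumLattice
open Summit.HubbardSuperconductivity.HubbardSuperconductivity.Theorems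

/-! ## §1 The common core: kernel total against the cell integral -/

/-- `sPos α ⇒ 0 < sUpZ α` (the rounded-up slope of a positive slope is positive). -/
theorem Params.sUpZ_pos (P : Params) (htpD : 0 < P.tpD) {α : ℤ} (h : P.sPos α = true) : 0 < P.sUpZ α := by
  have h1 := P.sPos_real htpD h
  have h2 := P.le_sUpZ htpD α
  have : (0 : ℝ) < ((P.sUpZ α : ℤ) : ℝ) := by
    have := h1.trans_le h2
    have h3 : (0 : ℝ) < ((P.sUpZ α : ℤ) : ℝ) / 2 ^ 40 := this
    exact (div_pos_iff_of_pos_right (by positivity)).mp h3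
  exact_mod_cast this

/-- `bStarDnZ α1 ≤ bStarUpZ α0` for `sPos` abscissae `α0 ≤ α1` (`b⋆` is antitone). -/
theorem Params.bStarDnZ_le_bStarUpZ (P : Params) (htpD : 0 < P.tpD) (hmuD : 0 < P.muD)
    (htμ : (P.tpN : ℝ) / (P.tpD : ℝ) * ((P.muN : ℝ) / (P.muD : ℝ)) < 1) {α0 α1 : ℤ} (hs0 : P.sPos α0 = true)
    (hs1 : P.sPos α1 = true) (hα : α0 ≤ α1) : P.bStarDnZ α1 ≤ P.bStarUpZ α0 := by
  have h1 := P.bStarDnZ_le htpD hmuD hs1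
  have h2 := P.le_bStarUpZ htpD hmuD hs0
  have h3 := bStar_le_bStar htμ (P.sPos_real htpD hs0) (P.sPos_real htpD hs1)
    (div_le_div_of_nonneg_right (by exact_mod_cast hα) (by positivity) : ((α0 : ℤ) : ℝ) / 2 ^ 40 ≤ ((α1 : ℤ) : ℝ) / 2 ^ 40)
  have : ((P.bStarDnZ α1 : ℤ) : ℝ) / 2 ^ 40 ≤ ((P.bStarUpZ α0 : ℤ) : ℝ) / 2 ^ 40 := h1.trans (h3.trans h2)
  have := (div_le_div_iff_of_pos_right (by positivity : (0 : ℝ) < 2 ^ 40)).mp this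
  exact_mod_cast this

/-- **THE COMMON CORE OF THE BOUNDARY FLOOR RULE**: on an oriented guarded cell with integrable integrand, given the real substitution
data for the straddler's shifted coordinates (`|sin| ≤ σ/10⁴`, `cos` injective, inner boxes `[aIn0, aIn1]/2^40`, `[bIn0, bIn1]/2^40` inside
the cosine images, `sPos` at `aIn0 ≤ aIn1`) and the pointwise minoration of the integrand by `fminR t′ μ far (Vhi/2^40)`, the kernel's total
`Σ_m bdryPieceLo (!far) Vhi (grid m) (grid (m+1)) bIn0 bIn1` satisfies `fdivZ (2^30·10^8·total) (σx σy D) ≤ 2^30 ∫_cell F`. -/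
theorem Params.floor_total_le (P : Params) (hP : P.admissible = true) {a b c d : ℤ} (hab : a ≤ b) (hcd : c ≤ d)
    (hF : IntegrableOn P.integrand (P.cellSet a b c d) volume) (far : Bool) {Vhi : ℤ} (hV : 0 < Vhi)
    {s1 s2 : ℝ} {σx σy : ℕ} (hσx : 0 < σx) (hσy : 0 < σy)
    (hsinx : ∀ x ∈ Icc ((a : ℝ) / (P.U : ℝ)) ((b : ℝ) / (P.U : ℝ)), |Real.sin (x + s1)| ≤ (σx : ℝ) / 10 ^ 4)
    (hinjx : InjOn Real.cos (Icc ((a : ℝ) / (P.U : ℝ) + s1) ((b : ℝ) / (P.U : ℝ) + s1)))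
    (hsiny : ∀ y ∈ Icc ((c : ℝ) / (P.U : ℝ)) ((d : ℝ) / (P.U : ℝ)), |Real.sin (y + s2)| ≤ (σy : ℝ) / 10 ^ 4)
    (hinjy : InjOn Real.cos (Icc ((c : ℝ) / (P.U : ℝ) + s2) ((d : ℝ) / (P.U : ℝ) + s2)))
    {aIn0 aIn1 bIn0 bIn1 : ℤ} (haa : aIn0 ≤ aIn1) (hs0 : P.sPos aIn0 = true) (hs1 : P.sPos aIn1 = true) (hbb : bIn0 ≤ bIn1)
    (hsubA : Icc (((aIn0 : ℤ) : ℝ) / 2 ^ 40) (((aIn1 : ℤ) : ℝ) / 2 ^ 40) ⊆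
      Real.cos '' Icc ((a : ℝ) / (P.U : ℝ) + s1) ((b : ℝ) / (P.U : ℝ) + s1))
    (hsubB : Icc (((bIn0 : ℤ) : ℝ) / 2 ^ 40) (((bIn1 : ℤ) : ℝ) / 2 ^ 40) ⊆
      Real.cos '' Icc ((c : ℝ) / (P.U : ℝ) + s2) ((d : ℝ) / (P.U : ℝ) + s2))
    (hdom : ∀ x ∈ Icc ((a : ℝ) / (P.U : ℝ)) ((b : ℝ) / (P.U : ℝ)), ∀ y ∈ Icc ((c : ℝ) / (P.U : ℝ)) ((d : ℝ) / (P.U : ℝ)),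
      fminR ((P.tpN : ℝ) / (P.tpD : ℝ)) ((P.muN : ℝ) / (P.muD : ℝ)) far (((Vhi : ℤ) : ℝ) / 2 ^ 40)
        (Real.cos (x + s1)) (Real.cos (y + s2)) ≤ P.integrand (pt x y)) :
    ((fdivZ (2 ^ 30 * 10 ^ 8 * ((List.range MA).map fun m =>
        P.bdryPieceLo (!far) Vhi (linGridZ aIn0 aIn1 MA m) (linGridZ aIn0 aIn1 MA (m + 1)) bIn0 bIn1).sum)
        ((σx : ℤ) * (σy : ℤ) * D) : ℤ) : ℝ) ≤ 2 ^ 30 * ∫ p in P.cellSet a b c d, P.integrand p := by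
  obtain ⟨htpD, hmuD, hU, -, -⟩ := P.admissible_facts hP
  have htμ := P.tmu_lt_one hP
  have hMA : 0 < MA := by decide
  set t := (P.tpN : ℝ) / (P.tpD : ℝ) with ht
  set μ := (P.muN : ℝ) / (P.muD : ℝ) with hμ
  set W := ((Vhi : ℤ) : ℝ) / 2 ^ 40 with hWdef
  have hW : 0 < W := div_pos (by exact_mod_cast hV) (by positivity)
  -- breakpoints and piece constants
  set A : ℕ → ℝ := fun m => ((linGridZ aIn0 aIn1 MA m : ℤ) : ℝ) / 2 ^ 40 with hA
  set cm : ℕ → ℝ := fun m => P.pieceLoR (!far) Vhi (linGridZ aIn0 aIn1 MA m) (linGridZ aIn0 aIn1 MA (m + 1)) bIn0 bIn1 with hcm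
  have hgrid : ∀ m, m ≤ MA → aIn0 ≤ linGridZ aIn0 aIn1 MA m ∧ linGridZ aIn0 aIn1 MA m ≤ aIn1 := fun m hm => linGridZ_mem haa hMA hm
  have hmonoZ : ∀ m, m < MA → linGridZ aIn0 aIn1 MA m ≤ linGridZ aIn0 aIn1 MA (m + 1) :=
    fun m _ => linGridZ_mono haa hMA (Nat.le_succ m)
  have hmono : ∀ m, m < MA → A m ≤ A (m + 1) := fun m hm => by
    simp only [hA]; exact div_le_div_of_nonneg_right (by exact_mod_cast hmonoZ m hm) (by positivity)
  have hsPos : ∀ m, m ≤ MA → P.sPos (linGridZ aIn0 aIn1 MA m) = true := fun m hm =>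
    P.sPos_between hs0 hs1 (hgrid m hm).1 (hgrid m hm).2
  have hA0 : A 0 = ((aIn0 : ℤ) : ℝ) / 2 ^ 40 := by simp only [hA, linGridZ_zero]
  have hAN : A MA = ((aIn1 : ℤ) : ℝ) / 2 ^ 40 := by simp only [hA, linGridZ_last aIn0 aIn1 hMA]
  have hsubA' : Icc (A 0) (A MA) ⊆ Real.cos '' Icc ((a : ℝ) / (P.U : ℝ) + s1) ((b : ℝ) / (P.U : ℝ) + s1) := by
    rw [hA0, hAN]; exact hsubA
  -- per-piece analytic floor
  have hc : ∀ m, m < MA → ∀ u ∈ Icc (A m) (A (m + 1)),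
      cm m ≤ ∫ v in Icc (((bIn0 : ℤ) : ℝ) / 2 ^ 40) (((bIn1 : ℤ) : ℝ) / 2 ^ 40), fminR t μ far W u v := by
    intro m hm u hu
    have := P.pieceLoR_le_integral htpD hmuD htμ (!far) bIn0 bIn1 hV (hsPos m hm.le) (hsPos (m + 1) hm) hu.1 hu.2
    simpa only [Bool.not_not] using this
  -- the 2-D substitution floor
  have hσx' : (0 : ℝ) < (σx : ℝ) / 10 ^ 4 := by positivity
  have hσy' : (0 : ℝ) < (σy : ℝ) / 10 ^ 4 := by positivity
  have core := P.floor2D_core hU hab hcd hF (M := fminR t μ far W) (fun u v => fminR_nonneg t μ far hW u v)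
    (fun u v => fminR_le t μ far hW u v) (measurable_fminR t μ far W) hσx' hσy' hsinx hinjx hsiny hinjy hmono hsubA'
    (div_le_div_of_nonneg_right (by exact_mod_cast hbb) (by positivity)) hsubB hdom hc
  -- the kernel total against the piece constants
  have htotal : ((((List.range MA).map fun m =>
      P.bdryPieceLo (!far) Vhi (linGridZ aIn0 aIn1 MA m) (linGridZ aIn0 aIn1 MA (m + 1)) bIn0 bIn1).sum : ℤ) : ℝ) ≤
      2 ^ 40 * ∑ m ∈ Finset.range MA, cm m * (A (m + 1) - A m) := by
    rw [list_range_map_sum, Int.cast_sum, Finset.mul_sum]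
    refine Finset.sum_le_sum fun m hm => ?_
    have hm' := Finset.mem_range.mp hm
    have h1 := P.bdryPieceLo_le (!far) (bIn0 := bIn0) (bIn1 := bIn1) hV (hmonoZ m hm')
      (lt_max_of_lt_left (P.sUpZ_pos htpD (hsPos m hm'.le)))
      (P.bStarDnZ_le_bStarUpZ htpD hmuD htμ (hsPos m hm'.le) (hsPos (m + 1) hm') (hmonoZ m hm'))
    refine h1.trans (le_of_eq ?_)
    simp only [hA, hcm]
    push_cast
    ring
  -- rounding of the outer `fdivZ`
  set Tz := ((List.range MA).map fun m =>
      P.bdryPieceLo (!far) Vhi (linGridZ aIn0 aIn1 MA m) (linGridZ aIn0 aIn1 MA (m + 1)) bIn0 bIn1).sum with hTz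
  set S := ∑ m ∈ Finset.range MA, cm m * (A (m + 1) - A m) with hS
  have hden : 0 < (σx : ℤ) * (σy : ℤ) * D := by
    have : (0 : ℤ) < D := by norm_num [D]
    positivity
  have hσx0 : (0 : ℝ) < (σx : ℝ) := by exact_mod_cast hσx
  have hσy0 : (0 : ℝ) < (σy : ℝ) := by exact_mod_cast hσy
  have h1 := fdivZ_le_div_real (2 ^ 30 * 10 ^ 8 * Tz) _ hden
  refine h1.trans ?_
  have e1 : (((2 ^ 30 * 10 ^ 8 * Tz : ℤ) : ℝ)) / ((((σx : ℤ) * (σy : ℤ) * D : ℤ) : ℝ)) =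
      2 ^ 30 * (10 ^ 8 * (Tz : ℝ) / ((σx : ℝ) * (σy : ℝ) * 2 ^ 40)) := by
    push_cast [cast_D_real]; ring
  rw [e1]
  refine mul_le_mul_of_nonneg_left ?_ (by positivity)
  calc 10 ^ 8 * (Tz : ℝ) / ((σx : ℝ) * (σy : ℝ) * 2 ^ 40) ≤ 10 ^ 8 * (2 ^ 40 * S) / ((σx : ℝ) * (σy : ℝ) * 2 ^ 40) :=
        div_le_div_of_nonneg_right (mul_le_mul_of_nonneg_left htotal (by norm_num)) (by positivity)
    _ = ((σx : ℝ) / 10 ^ 4)⁻¹ * ((σy : ℝ) / 10 ^ 4)⁻¹ * S := by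
        field_simp
    _ ≤ ∫ p in P.cellSet a b c d, P.integrand p := core

/-! ## §2 The two straddler orientations -/

/-- Real form of a shifted grid abscissa: `((z + q : ℤ) : ℝ)/U = z/U + q/U`. -/
theorem cast_add_div (z q U : ℤ) : (((z + q : ℤ) : ℝ)) / (U : ℝ) = (z : ℝ) / (U : ℝ) + (q : ℝ) / (U : ℝ) := by
  push_cast; ring

/-- **STRADDLER `p + q` (`sh = true`)**: the kernel total built from the primed inner boxes is `≤ 2^30 ∫_cell F`. -/
theorem Params.floor_sh (P : Params) (hP : P.admissible = true) {a b c d : ℤ} (hin : P.InRoot a b c d) (hab : a ≤ b) (hcd : c ≤ d)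
    (hF : IntegrableOn P.integrand (P.cellSet a b c d) volume) (far : Bool)
    (hg : (P.cell (P.mkX a) (P.mkX b) (P.mkY c) (P.mkY d)).guards = true)
    (hs1 : P.status (P.cell (P.mkX a) (P.mkX b) (P.mkY c) (P.mkY d)).e1Lo (P.cell (P.mkX a) (P.mkX b) (P.mkY c) (P.mkY d)).e1Hi = some far)
    (hV : 0 < P.distHiZ (P.cell (P.mkX a) (P.mkX b) (P.mkY c) (P.mkY d)).e1Lo (P.cell (P.mkX a) (P.mkX b) (P.mkY c) (P.mkY d)).e1Hi)
    {σx σy : ℕ} (hσx : 0 < σx) (hσy : 0 < σy)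
    (hsx : sinHiOK (P.cell (P.mkX a) (P.mkX b) (P.mkY c) (P.mkY d)).aLo' (P.cell (P.mkX a) (P.mkX b) (P.mkY c) (P.mkY d)).aUp' σx = true)
    (hsy : sinHiOK (P.cell (P.mkX a) (P.mkX b) (P.mkY c) (P.mkY d)).bLo' (P.cell (P.mkX a) (P.mkX b) (P.mkY c) (P.mkY d)).bUp' σy = true)
    {aIn0 aIn1 bIn0 bIn1 : ℤ}
    (haI : P.cosInnerZ (a + P.q1z) (b + P.q1z) (P.mkX a).lo' (P.mkX a).hi' (P.mkX b).lo' (P.mkX b).hi' = some (aIn0, aIn1))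
    (hbI : P.cosInnerZ (c + P.q2z) (d + P.q2z) (P.mkY c).lo' (P.mkY c).hi' (P.mkY d).lo' (P.mkY d).hi' = some (bIn0, bIn1))
    (haa : aIn0 ≤ aIn1) (hbb : bIn0 ≤ bIn1) (hsp0 : P.sPos aIn0 = true) (hsp1 : P.sPos aIn1 = true) :
    ((fdivZ (2 ^ 30 * 10 ^ 8 * ((List.range MA).map fun m =>
        P.bdryPieceLo (!far) (P.distHiZ (P.cell (P.mkX a) (P.mkX b) (P.mkY c) (P.mkY d)).e1Lo
          (P.cell (P.mkX a) (P.mkX b) (P.mkY c) (P.mkY d)).e1Hi)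
          (linGridZ aIn0 aIn1 MA m) (linGridZ aIn0 aIn1 MA (m + 1)) bIn0 bIn1).sum) ((σx : ℤ) * (σy : ℤ) * D) : ℤ) : ℝ) ≤
      2 ^ 30 * ∫ p in P.cellSet a b c d, P.integrand p := by
  obtain ⟨htpD, hmuD, hU, -, -⟩ := P.admissible_facts hP
  obtain ⟨ha, -, -, hb, hc, -, -, hd⟩ := id hin
  have ex0 := cast_add_div a P.q1z P.U
  have ex1 := cast_add_div b P.q1z P.U
  have ey0 := cast_add_div c P.q2z P.U
  have ey1 := cast_add_div d P.q2z P.U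
  refine P.floor_total_le hP hab hcd hF far hV (s1 := (P.q1z : ℝ) / (P.U : ℝ)) (s2 := (P.q2z : ℝ) / (P.U : ℝ)) hσx hσy
    ?_ ?_ ?_ ?_ haa hsp0 hsp1 hbb ?_ ?_ ?_
  · intro x hx
    obtain ⟨α1, α2⟩ := P.cell_cosx'_mem hP (c := c) (d := d) ha hb hx.1 hx.2
    exact abs_sin_le_of_sinHiOK hsx α1 α2
  · rcases P.cosInnerZ_eq haI with ⟨hdir, -, -⟩ | ⟨hdir, -, -⟩
    · have := P.injOn_cos_of_cosDirZ hP hdir; rwa [ex0, ex1] at this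
    · have := P.injOn_cos_of_cosDirZ hP hdir; rwa [ex0, ex1] at this
  · intro y hy
    obtain ⟨β1, β2⟩ := P.cell_cosy'_mem hP (a := a) (b := b) hc hd hy.1 hy.2
    exact abs_sin_le_of_sinHiOK hsy β1 β2
  · rcases P.cosInnerZ_eq hbI with ⟨hdir, -, -⟩ | ⟨hdir, -, -⟩
    · have := P.injOn_cos_of_cosDirZ hP hdir; rwa [ey0, ey1] at this
    · have := P.injOn_cos_of_cosDirZ hP hdir; rwa [ey0, ey1] at this
  · have := P.cosInnerZ_sound hP haI (by linarith) (P.mkX_lo'_le hU a) (P.le_mkX_hi' hU a) (P.mkX_lo'_le hU b) (P.le_mkX_hi' hU b)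
    rwa [ex0, ex1] at this
  · have := P.cosInnerZ_sound hP hbI (by linarith) (P.mkY_lo'_le hU c) (P.le_mkY_hi' hU c) (P.mkY_lo'_le hU d) (P.le_mkY_hi' hU d)
    rwa [ey0, ey1] at this
  · intro x hx y hy
    exact P.fminR_le_integrand_sh hP hin far hg hs1 hx hy

/-- **STRADDLER `p` (`sh = false`)**: the kernel total built from the unprimed inner boxes is `≤ 2^30 ∫_cell F`. -/
theorem Params.floor_nsh (P : Params) (hP : P.admissible = true) {a b c d : ℤ} (hin : P.InRoot a b c d) (hab : a ≤ b) (hcd : c ≤ d)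
    (hF : IntegrableOn P.integrand (P.cellSet a b c d) volume) (far : Bool)
    (hg : (P.cell (P.mkX a) (P.mkX b) (P.mkY c) (P.mkY d)).guards = true)
    (hs2 : P.status (P.cell (P.mkX a) (P.mkX b) (P.mkY c) (P.mkY d)).e2Lo (P.cell (P.mkX a) (P.mkX b) (P.mkY c) (P.mkY d)).e2Hi = some far)
    (hV : 0 < P.distHiZ (P.cell (P.mkX a) (P.mkX b) (P.mkY c) (P.mkY d)).e2Lo (P.cell (P.mkX a) (P.mkX b) (P.mkY c) (P.mkY d)).e2Hi)
    {σx σy : ℕ} (hσx : 0 < σx) (hσy : 0 < σy)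
    (hsx : sinHiOK (P.cell (P.mkX a) (P.mkX b) (P.mkY c) (P.mkY d)).aLo (P.cell (P.mkX a) (P.mkX b) (P.mkY c) (P.mkY d)).aUp σx = true)
    (hsy : sinHiOK (P.cell (P.mkX a) (P.mkX b) (P.mkY c) (P.mkY d)).bLo (P.cell (P.mkX a) (P.mkX b) (P.mkY c) (P.mkY d)).bUp σy = true)
    {aIn0 aIn1 bIn0 bIn1 : ℤ}
    (haI : P.cosInnerZ a b (P.mkX a).lo (P.mkX a).hi (P.mkX b).lo (P.mkX b).hi = some (aIn0, aIn1))
    (hbI : P.cosInnerZ c d (P.mkY c).lo (P.mkY c).hi (P.mkY d).lo (P.mkY d).hi = some (bIn0, bIn1))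
    (haa : aIn0 ≤ aIn1) (hbb : bIn0 ≤ bIn1) (hsp0 : P.sPos aIn0 = true) (hsp1 : P.sPos aIn1 = true) :
    ((fdivZ (2 ^ 30 * 10 ^ 8 * ((List.range MA).map fun m =>
        P.bdryPieceLo (!far) (P.distHiZ (P.cell (P.mkX a) (P.mkX b) (P.mkY c) (P.mkY d)).e2Lo
          (P.cell (P.mkX a) (P.mkX b) (P.mkY c) (P.mkY d)).e2Hi)
          (linGridZ aIn0 aIn1 MA m) (linGridZ aIn0 aIn1 MA (m + 1)) bIn0 bIn1).sum) ((σx : ℤ) * (σy : ℤ) * D) : ℤ) : ℝ) ≤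
      2 ^ 30 * ∫ p in P.cellSet a b c d, P.integrand p := by
  obtain ⟨htpD, hmuD, hU, -, -⟩ := P.admissible_facts hP
  obtain ⟨ha, -, -, hb, hc, -, -, hd⟩ := id hin
  refine P.floor_total_le hP hab hcd hF far hV (s1 := 0) (s2 := 0) hσx hσy ?_ ?_ ?_ ?_ haa hsp0 hsp1 hbb ?_ ?_ ?_
  · intro x hx
    obtain ⟨α1, α2⟩ := P.cell_cosx_mem hP (c := c) (d := d) ha hb hx.1 hx.2
    rw [add_zero]; exact abs_sin_le_of_sinHiOK hsx α1 α2
  · rw [add_zero, add_zero]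
    rcases P.cosInnerZ_eq haI with ⟨hdir, -, -⟩ | ⟨hdir, -, -⟩
    · exact P.injOn_cos_of_cosDirZ hP hdir
    · exact P.injOn_cos_of_cosDirZ hP hdir
  · intro y hy
    obtain ⟨β1, β2⟩ := P.cell_cosy_mem hP (a := a) (b := b) hc hd hy.1 hy.2
    rw [add_zero]; exact abs_sin_le_of_sinHiOK hsy β1 β2
  · rw [add_zero, add_zero]
    rcases P.cosInnerZ_eq hbI with ⟨hdir, -, -⟩ | ⟨hdir, -, -⟩
    · exact P.injOn_cos_of_cosDirZ hP hdir
    · exact P.injOn_cos_of_cosDirZ hP hdir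
  · rw [add_zero, add_zero]
    exact P.cosInnerZ_sound hP haI hab (P.mkX_lo_le hU a) (P.le_mkX_hi hU a) (P.mkX_lo_le hU b) (P.le_mkX_hi hU b)
  · rw [add_zero, add_zero]
    exact P.cosInnerZ_sound hP hbI hcd (P.mkY_lo_le hU c) (P.le_mkY_hi hU c) (P.mkY_lo_le hU d) (P.le_mkY_hi hU d)
  · intro x hx y hy
    exact P.fminR_le_integrand_nsh hP hin far hg hs2 hx hy

/-! ## §3 The boundary FLOOR rule is sound -/

/-- **THE BOUNDARY FLOOR RULE (oriented, of record) IS SOUND**: `FloorBdrySoundOrd P` for every parameter record `P` — the boundary floor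
term `floorBdry … sh (!far) σx σy` of a guarded, oriented grid cell inside the root square and the floor zone, one of whose points has a
certified status `far`, is at most `2^30 ·` the BZ-part of the cell integral, for EVERY hint payload (hints are checked inside the rule). -/
theorem floorBdrySoundOrd (P : Params) : FloorBdrySoundOrd P := by
  intro a b c d sh far σx σy hP hin hab hcd hg hs1 hs2 hbz hInt
  have hF : IntegrableOn P.integrand (P.cellSet a b c d) volume := hInt.mono_set (P.cellSet_subset_brillouinZone hP hbz)
  rw [P.cellIntBZ_eq_cellInt hP hbz]
  have hnn : (0 : ℝ) ≤ 2 ^ 30 * P.cellInt a b c d :=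
    mul_nonneg (by norm_num) (setIntegral_nonneg (P.measurableSet_cellSet a b c d) fun p _ => P.integrand_nonneg p)
  cases sh
  · -- straddler `p`, far point `p + q`
    simp only [Bool.false_eq_true, ↓reduceIte] at hs1 hs2
    simp only [Params.floorBdry, Params.mkX_z, Params.mkY_z, Bool.false_eq_true, ↓reduceIte]
    split
    · rename_i aIn0 aIn1 bIn0 bIn1 haI hbI
      split
      · rename_i hmain
        simp only [Bool.and_eq_true, decide_eq_true_eq] at hmain
        obtain ⟨⟨⟨⟨⟨⟨⟨⟨⟨hsx, hsy⟩, hσ⟩, hV⟩, haa⟩, hbb⟩, hsp0⟩, hsp1⟩, -⟩, -⟩ := hmain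
        have hσx : 0 < σx := Nat.pos_of_ne_zero fun h => by simp [h] at hσ
        have hσy : 0 < σy := Nat.pos_of_ne_zero fun h => by simp [h] at hσ
        exact P.floor_nsh hP hin hab hcd hF far hg hs2 hV hσx hσy hsx hsy haI hbI haa.le hbb.le hsp0 hsp1
      · simpa using hnn
    · simpa using hnn
  · -- straddler `p + q`, far point `p`
    simp only [↓reduceIte] at hs1 hs2
    simp only [Params.floorBdry, Params.mkX_z, Params.mkY_z, ↓reduceIte]
    split
    · rename_i aIn0 aIn1 bIn0 bIn1 haI hbI
      split
      · rename_i hmain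
        simp only [Bool.and_eq_true, decide_eq_true_eq] at hmain
        obtain ⟨⟨⟨⟨⟨⟨⟨⟨⟨hsx, hsy⟩, hσ⟩, hV⟩, haa⟩, hbb⟩, hsp0⟩, hsp1⟩, -⟩, -⟩ := hmain
        have hσx : 0 < σx := Nat.pos_of_ne_zero fun h => by simp [h] at hσ
        have hσy : 0 < σy := Nat.pos_of_ne_zero fun h => by simp [h] at hσ
        exact P.floor_sh hP hin hab hcd hF far hg hs1 hV hσx hσy hsx hsy haI hbI haa.le hbb.le hsp0 hsp1
      · simpa using hnn
    · simpa using hnn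

/-- **THE (22) INSTRUMENT'S FLOOR SIDE IS DISCHARGED**: `FloorSoundAt P t` for every parameter record and every certificate tree
(`floorInsideSoundOrd` of `…Jensen` + `floorBdrySoundOrd`, via `…FloorRulesOrd.floorSoundAt_of_rulesOrd`). -/
theorem floorSoundAt_holds (P : Params) (t : QB) : FloorSoundAt P t :=
  floorSoundAt_of_rulesOrd P (floorInsideSoundOrd P) (floorBdrySoundOrd P) t

end Summit.HubbardSuperconductivity.HubbardSuperconductivity.Theorems.KlLindhardEnclosure

end
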